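import Literature.AlgebraicGeometry.Motives.AbelianVarietyProjectiveChart
import Literature.AlgebraicGeometry.HodgeTheory.ComplexBettiKunneth
import Literature.AlgebraicGeometry.HodgeTheory.GlobalInvariantCyclesProofs
import HarnessLib

/-!
# Pull-back on `H¹(A(ℂ); ℂ)` is additive in the homomorphism (stub `stub_endAdditiveH1`)

Line `Sketch` (idea `dicyclic-quaternion-switch`) of crux
`HeckePrymWeil.HyperbolicEightfoldsSqrtMinus7` (item stmt-HodgeConjecture-14642): the registered
stub `stub_endAdditiveH1`, PROVED on the real carriers `complexBetti A.X 1 = H¹(A(ℂ); ℂ)`.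

For homomorphisms `f, g : A ⟶ A` of a complex abelian variety, `(f + g)^* = f^* + g^*` on
`H¹(A(ℂ); ℂ)` (Lange–Birkenhake, *Complex Abelian Varieties* (1992), Ch. 1 §1, 1.1.2
"Homomorphisms of Complex Tori", p. 10: the rational representation
`ρ_r : Hom(X, X') → Hom_ℤ(Λ, Λ')` is a homomorphism of abelian groups, and Lemma 1.1.17 (a):
`H¹(X, ℤ) = Hom(Λ, ℤ)`, `Λ = H₁(X, ℤ)` by (1.3)–(1.4), so `f^*|H¹ = ᵗρ_r(f)`; Mumford, *Abelian
Varieties*, §1 for the cohomology of complex tori). The proof is the classical topological one —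
degree-one classes are primitive for the group law — the twin of the tree's abstract
`Motives.WeilCohomology.pullback_mul_deg_one` / `pullback_mu_of_deg_one`, run on singular cohomology
of the complex points:

* `complexBetti_map_one_deg_one` — the trivial homomorphism `1 = toUnit ≫ η` kills `H¹`, because it
  factors through the point `𝟙_ (SchemeOver ℂ) = Spec ℂ`, whose `H¹` vanishes
  (`HodgeTheory.subsingleton_complexBetti` with `Motives.isSmoothProjective_unit_holds`);
* `exists_eq_map_fst_add_map_snd_deg_one` — **Künneth in degree one**: for smooth projective `Y`,
  `Z`, every class of `H¹((Y ⊗ Z)(ℂ); ℂ)` is `fst^* a + snd^* b` — the tree's PROVED Künneth theorem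
  `HodgeTheory.complexBetti_kunneth_bijective` (Hatcher Thm. 3.16: `(a_j) ↦ Σ_j fst^* a_j ∪ snd^* b_j`
  is bijective for bases `b_j` of `H*(Z(ℂ))`) in degree `1`, where the cross products are
  `fst^* a ∪ snd^* (c • 1) = c • fst^* a` and `fst^* (c • 1) ∪ snd^* b = c • snd^* b` since
  `H⁰ = ℂ · 1` on the path-connected spaces `Y(ℂ)`, `Z(ℂ)`
  (`HodgeTheory.pathConnectedSpace_complexPoints`, SGA1 XII 2.4; `singularCohomology.exists_eq_smul_one`);
* `complexBetti_map_mul_deg_one` — **degree-one classes are primitive**: `m^* v = fst^* v + snd^* v`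
  for the group law `m = μ[A.X] : A ⊗ A ⟶ A`; write `m^* v = fst^* a + snd^* b` and pull back along
  the two sections `(𝟙, 1)`, `(1, 𝟙) : A ⟶ A ⊗ A` (`(𝟙, 1) ≫ m = 𝟙 · 1 = 𝟙`) to get `a = v = b`;
* `complexBetti_map_hom_mul_deg_one` — `(p · q)^* v = p^* v + q^* v` for `p q : T ⟶ A.X`
  (`p · q = lift p q ≫ m`), and the registered signature `stub_endAdditiveH1`
  (`(f + g).hom.hom.hom = f.hom.hom.hom · g.hom.hom.hom`, `AbelianVariety.hom_add`).

Smooth projectivity of `A.X` is the tree's PROVED `AbelianVariety.isSmoothProjective_holds`.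
Everything is proved; no named facts, no definitions.

## References

* [LangeBirkenhake1992] H. Lange, Ch. Birkenhake, Complex Abelian Varieties, Springer 1992, Ch. 1
  §1: 1.1.2 (p. 10, the analytic and rational representations of `Hom(X, X')`), Lemma 1.1.17 (a).
* [MumfordAV1970] D. Mumford, Abelian Varieties, OUP 1970, §1 (cohomology of a complex torus).
* [HatcherAT2002] A. Hatcher, Algebraic Topology, CUP 2002, §3.2 Thm. 3.15–3.16 (Künneth).
-/

noncomputable section

-- `Summit.HodgeConjecture.HodgeConjecture.…`: summit and problem share the name (single-problem summit, §1).
set_option linter.dupNamespace false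

open CategoryTheory AlgebraicGeometry MonoidalCategory CartesianMonoidalCategory
open Literature.AlgebraicGeometry Literature.AlgebraicGeometry.Motives
  Literature.AlgebraicGeometry.HodgeTheory Literature.AlgebraicTopology.SingularHomology
open scoped MonObj

namespace Summit.HodgeConjecture.HodgeConjecture.Theorems.HyperbolicEightfoldsSqrtMinus7.DicyclicQuaternionSwitch

/-- **The trivial homomorphism kills `H¹`**: for the constant map `1 = toUnit T ≫ η : T ⟶ A` at the
neutral element of a `ℂ`-group scheme `A`, `1^* = 0` on `H¹(A(ℂ); ℂ)`, since `1` factors through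
`Spec ℂ`, a point, and `H¹(pt; ℂ) = 0` (`HodgeTheory.subsingleton_complexBetti` for the smooth
projective `0`-fold `𝟙_ (SchemeOver ℂ)`, `Motives.isSmoothProjective_unit_holds`).
[cite: MumfordAV1970, §1] -/
theorem complexBetti_map_one_deg_one {T A : SchemeOver ℂ} [MonObj A] (v : complexBetti A 1) :
    complexBetti.map (1 : T ⟶ A) 1 v = 0 := by
  haveI : Subsingleton (complexBetti (𝟙_ (SchemeOver ℂ)) 1) :=
    subsingleton_complexBetti (isSmoothProjective_unit_holds ℂ) (by norm_num)
  rw [Hom.one_def, complexBetti.map_comp, CategoryTheory.comp_apply,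
    Subsingleton.elim (complexBetti.map η[A] 1 v) 0, map_zero]

/-- **Künneth in degree one for the complex points of a product of smooth projective varieties**:
every class `z ∈ H¹((Y ⊗ Z)(ℂ); ℂ)` is `fst^* a + snd^* b` for some `a ∈ H¹(Y(ℂ); ℂ)`,
`b ∈ H¹(Z(ℂ); ℂ)`. From the Künneth theorem (`HodgeTheory.complexBetti_kunneth_bijective`, Hatcher
Thm. 3.16: `z = Σ_j fst^* a_j ∪ snd^* b_j` over bases `b_j` of the `Hʲ(Z(ℂ); ℂ)`, `deg a_j + j = 1`)
and `H⁰ = ℂ · 1` for the path-connected spaces `Y(ℂ)`, `Z(ℂ)`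
(`HodgeTheory.pathConnectedSpace_complexPoints`, `singularCohomology.exists_eq_smul_one`), with
`fst^* 1 = 1 = snd^* 1` and the unit laws of `∪`. [cite: HatcherAT2002, §3.2 Thm. 3.16] -/
theorem exists_eq_map_fst_add_map_snd_deg_one {m n : ℕ} {Y Z : SchemeOver ℂ}
    (hY : IsSmoothProjective m Y) (hZ : IsSmoothProjective n Z) (z : complexBetti (Y ⊗ Z) 1) :
    ∃ (a : complexBetti Y 1) (b : complexBetti Z 1),
      z = complexBetti.map (fst Y Z) 1 a + complexBetti.map (snd Y Z) 1 b := by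
  classical
  haveI := pathConnectedSpace_complexPoints hY
  haveI := pathConnectedSpace_complexPoints hZ
  haveI := fun j ↦ finite_complexBetti hZ j
  -- it suffices that `z ∈ S = range fst^* ⊔ range snd^*`
  set S : Submodule ℂ (complexBetti (Y ⊗ Z) 1) := LinearMap.range (complexBetti.map (fst Y Z) 1).hom ⊔
    LinearMap.range (complexBetti.map (snd Y Z) 1).hom
  suffices h : z ∈ S by
    obtain ⟨x, hx, y, hy, hxy⟩ := Submodule.mem_sup.1 h
    obtain ⟨a, rfl⟩ := LinearMap.mem_range.1 hx
    obtain ⟨b, rfl⟩ := LinearMap.mem_range.1 hy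
    exact ⟨a, b, hxy.symm⟩
  -- cross products of total degree one lie in `S`
  have hcross : ∀ {p q : ℕ} (h : p + q = 1) (a : complexBetti Y p) (w : complexBetti Z q),
      cupProduct h (complexBetti.map (fst Y Z) p a) (complexBetti.map (snd Y Z) q w) ∈ S := by
    intro p q h a w
    obtain ⟨rfl, rfl⟩ | ⟨rfl, rfl⟩ : p = 0 ∧ q = 1 ∨ p = 1 ∧ q = 0 := by omega
    · -- `fst^* (c • 1) ∪ snd^* w = c • snd^* w`
      obtain ⟨c, rfl⟩ := singularCohomology.exists_eq_smul_one a
      rw [map_smul, singularCohomology.map_one, LinearMap.map_smul₂, one_cupProduct]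
      exact Submodule.mem_sup_right (Submodule.smul_mem _ _ (LinearMap.mem_range_self _ w))
    · -- `fst^* a ∪ snd^* (c • 1) = c • fst^* a`
      obtain ⟨c, rfl⟩ := singularCohomology.exists_eq_smul_one w
      rw [map_smul, singularCohomology.map_one, LinearMap.map_smul, cupProduct_one]
      exact Submodule.mem_sup_left (Submodule.smul_mem _ _ (LinearMap.mem_range_self _ a))
  -- Künneth: `z = Σ_j fst^* a_j ∪ snd^* b_j` for the standard bases `b_j` of the `Hʲ(Z(ℂ); ℂ)`
  obtain ⟨a, rfl⟩ := (complexBetti_kunneth_bijective hY hZ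
    (fun j ↦ Module.finBasis ℂ (complexBetti Z j)) 1).2 z
  rw [LerayHirsch.lhMap_apply]
  refine Submodule.sum_mem _ fun j _ ↦ ?_
  split_ifs with h
  · exact hcross _ _ _
  · exact Submodule.zero_mem _

/-- **Degree-one classes of a complex abelian variety are primitive**: for the group law
`m = μ[A.X] : A ⊗ A ⟶ A`, `m^* v = fst^* v + snd^* v` in `H¹((A ⊗ A)(ℂ); ℂ)` for every
`v ∈ H¹(A(ℂ); ℂ)` (Mumford, *Abelian Varieties*, §1: `H•(A)` is a Hopf algebra, `H¹` is primitive;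
the abstract twin is `Motives.WeilCohomology.pullback_mu_of_deg_one`). Proof: by Künneth in degree
one `m^* v = fst^* a + snd^* b`; pulling back along the section `(𝟙, 1) : A ⟶ A ⊗ A`
(`(𝟙, 1) ≫ m = 𝟙 · 1 = 𝟙`, `(𝟙, 1) ≫ fst = 𝟙`, `(𝟙, 1) ≫ snd = 1`, and `1^* = 0` on `H¹`) gives
`v = a`, and symmetrically `v = b`. [cite: MumfordAV1970, §1] -/
theorem complexBetti_map_mul_deg_one (A : AbelianVariety ℂ) (v : complexBetti A.X 1) :
    complexBetti.map μ[A.X] 1 v =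
      complexBetti.map (fst A.X A.X) 1 v + complexBetti.map (snd A.X A.X) 1 v := by
  have hA : IsSmoothProjective A.dim A.X := AbelianVariety.isSmoothProjective_holds
  obtain ⟨a, b, hab⟩ := exists_eq_map_fst_add_map_snd_deg_one hA hA (complexBetti.map μ[A.X] 1 v)
  -- the two sections of the projections through the neutral element
  have e₁ : lift (𝟙 A.X) (1 : A.X ⟶ A.X) ≫ μ[A.X] = 𝟙 A.X := by rw [← Hom.mul_def, mul_one]
  have e₂ : lift (1 : A.X ⟶ A.X) (𝟙 A.X) ≫ μ[A.X] = 𝟙 A.X := by rw [← Hom.mul_def, one_mul]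
  have ha : v = a := by
    have h := congrArg (complexBetti.map (lift (𝟙 A.X) (1 : A.X ⟶ A.X)) 1) hab
    rwa [map_add, ← CategoryTheory.comp_apply, ← complexBetti.map_comp, e₁, complexBetti.map_id,
      CategoryTheory.id_apply, ← CategoryTheory.comp_apply, ← complexBetti.map_comp, lift_fst,
      complexBetti.map_id, CategoryTheory.id_apply, ← CategoryTheory.comp_apply,
      ← complexBetti.map_comp, lift_snd, complexBetti_map_one_deg_one, add_zero] at h
  have hb : v = b := by
    have h := congrArg (complexBetti.map (lift (1 : A.X ⟶ A.X) (𝟙 A.X)) 1) hab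
    rwa [map_add, ← CategoryTheory.comp_apply, ← complexBetti.map_comp, e₂, complexBetti.map_id,
      CategoryTheory.id_apply, ← CategoryTheory.comp_apply, ← complexBetti.map_comp, lift_fst,
      complexBetti_map_one_deg_one, zero_add, ← CategoryTheory.comp_apply,
      ← complexBetti.map_comp, lift_snd, complexBetti.map_id, CategoryTheory.id_apply] at h
  rw [hab, ← ha, ← hb]

/-- **Pull-back on `H¹` turns the pointwise product of morphisms into the sum**: for `ℂ`-morphisms
`p q : T ⟶ A` into a complex abelian variety, with pointwise product `p · q = lift p q ≫ m`
(Mathlib's `Hom.mul_def`), `(p · q)^* v = p^* v + q^* v` on `H¹(A(ℂ); ℂ)` — from primitivity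
(`complexBetti_map_mul_deg_one`) and functoriality. This is the `complexBetti` twin of the tree's
`Motives.WeilCohomology.pullback_mul_deg_one`. [cite: MumfordAV1970, §1] -/
theorem complexBetti_map_hom_mul_deg_one (A : AbelianVariety ℂ) {T : SchemeOver ℂ}
    (p q : T ⟶ A.X) (v : complexBetti A.X 1) :
    complexBetti.map (p * q) 1 v = complexBetti.map p 1 v + complexBetti.map q 1 v := by
  rw [Hom.mul_def, complexBetti.map_comp, CategoryTheory.comp_apply, complexBetti_map_mul_deg_one,
    map_add, ← CategoryTheory.comp_apply, ← complexBetti.map_comp, lift_fst,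
    ← CategoryTheory.comp_apply, ← complexBetti.map_comp, lift_snd]

/-- **Stub `stub_endAdditiveH1` — pull-back on `H¹` is additive in the endomorphism.** For
homomorphisms `f, g : A ⟶ A` of a complex abelian variety, `(f + g)^* = f^* + g^*` on
`H¹(A(ℂ); ℂ)`: the rational representation `ρ_r : End(A) → End_ℤ(Λ)`, `Λ = H₁(A(ℂ), ℤ)`, is a
homomorphism of abelian groups (Lange–Birkenhake 1992, Ch. 1 §1, 1.1.2, p. 10) and
`H¹(A(ℂ), ℤ) = Hom(Λ, ℤ)` (Lemma 1.1.17 (a)); Mumford, *Abelian Varieties*, §1. Here `f + g` is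
the pointwise product of group-scheme homomorphisms (`AbelianVariety.hom_add`, Mathlib's
`Hom.commGroup`), so this is `complexBetti_map_hom_mul_deg_one` for
`(f + g).hom.hom.hom = f.hom.hom.hom · g.hom.hom.hom`.
[cite: LangeBirkenhake1992, Ch. 1 §1 (1.1.2) p. 10 and Lemma 1.1.17 (a)] [cite: MumfordAV1970, §1] -/
theorem stub_endAdditiveH1 :
    ∀ (A : AbelianVariety ℂ) (f g : A ⟶ A) (v : complexBetti A.X 1),
      complexBetti.map (f + g).hom.hom.hom 1 v =
        complexBetti.map f.hom.hom.hom 1 v + complexBetti.map g.hom.hom.hom 1 v := by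
  intro A f g v
  change complexBetti.map (f.hom.hom.hom * g.hom.hom.hom) 1 v = _
  exact complexBetti_map_hom_mul_deg_one A _ _ v

end Summit.HodgeConjecture.HodgeConjecture.Theorems.HyperbolicEightfoldsSqrtMinus7.DicyclicQuaternionSwitch

end
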